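import Literature.NumberTheory.EllipticCurves.SexticTwistFiveReciprocity
import HarnessLib

/-!
# The `5`-part of the theta coefficient of `y² = x³ + k`: `Φ_k = (γ/5)₆^{v₅(k)} · Φ_{k₁}` (sextic reciprocity at the inert prime `5`)

Topic `Literature/NumberTheory/EllipticCurves`, namespace `Literature.NumberTheory.EllipticCurves.SexticTwist` (sequel to
`SexticTwistThetaDictionary`).  Theorems only (no definition, no named fact).  The `j = 0` twin of
`QuarticTwistThetaDictionaryInert` (`Ψ_D = \overline{(·/q)₄}^k · Ψ'` at an inert `q ≡ 3 (4)` of `ℤ[i]`), at the prime `q = 5` — inert in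
`ℤ[ω]`, `𝓞 K3 ⧸ (5) = 𝔽₂₅` — which is the prime of the BSD programme's `j = 0` supercuspidal cell (Kodaira `II, IV, IV*, II*` for
`v₅(k) = 1, 2, 4, 5`).

For `k = 5^e k₁` with `5 ∤ k₁`, the weight `W_k(x) = 𝟙[x ≡ 1 (3)] c(N x) (k/N x) ν_{4k}((x))` of `SexticTwistThetaDictionary` factors as

  **`W_k(x) = \overline{e((x/5)₆)}^e · W_{k₁}(x)`**  (`weight_five_split`),

with `(·/5)₆ = sexticResidueSymbol (5)` the sextic residue symbol of `ℤ[ω]` at `(5)` (`GaloisRepresentations/SexticResidueSymbol`),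
`e = embC`.  The three inputs, all instances of «`(a/𝔭)₆⁻¹ = (a/𝔭)₃ (a/𝔭)₂`»:

* §1 (prequel `SexticTwistFiveReciprocity`) `grossenNu_mul_left` — `ν_{DD'}(𝔞) = ν_D(𝔞) ν_{D'}(𝔞)` on `(𝔞, 3DD') = 1` (prime by prime `χ_𝔭(DD') = χ_𝔭(D)χ_𝔭(D')`, then unique
  factorisation of ideals); ★ `psi_five_eq_cubicResidueSymbol_primGen` — **cubic reciprocity for the rational prime `5`**:
  `ν_5(𝔞) = e((ϖ_𝔞/5)₃)` for `(𝔞, 15) = 1` (prime by prime Ireland–Rosen Ch. 9 §4: `χ_𝔭(5) = χ_{(5)}(J(χ_𝔭, χ_𝔭))` — the tree's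
  `cubicResidueSymbol_natCast_eq_cubicResidueSymbol_cubicJacobiSum` — and `J(χ_𝔭, χ_𝔭) = −ϖ_𝔭`, `cubicJacobiSum_eq_neg_of_span_eq`);
* §2 (prequel) the residue field `𝔽₂₅ = 𝓞 K3 ⧸ (5)`: Frobenius is complex conjugation (`mk_pow_five_eq_mk_tau`), `N(α) ≡ α⁶`, hence
  ★ `jacobiSym_five_absNorm_eq` — **`(5/N α) = (N α/5) = e((α/5)₆)³`** (quadratic reciprocity for the Jacobi symbol and Euler's criterion
  `(α/5)₆³ ≡ α¹²`); `embC_sexticResidueSymbol_tau` — `e((τα/5)₆) = \overline{e((α/5)₆)}`;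
* §3 `weight_five_split` and, in the `ℤ²`-coordinates of `QuadOrder` (`γ = y₁ + y₂ω₃ = y₂ρ + (y₁ + y₂)`, `γ = \overline{e(x)}`),
  `thetaWeight_five_split` — `Φ_k(y) = Φ₅(y₂, y₁ + y₂) · Φ_{k₁}(y)` with `Φ₅(c₁, c₂) = e(((c₁ρ + c₂)/5)₆)^e` on `(ℤ/5)²`, multiplicative,
  `Φ₅(0) = 0`, `Φ₅(1 − ρ) = Φ₅(−1, 1) = (−ρ²)^e`;
* §4 ★ `lSeries_twist_eq_thetaLFunction_five` — the dictionary of `SexticTwistThetaDictionary` re-levelled at `5 · M′`, `M′ = 36|k₁|m`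
  prime to `5`, with the coefficient in the split form `Φ₅(y₂, y₁ + y₂) · Ψ(y)`, `Ψ = Φ_{k₁}` periodic modulo `M′` with algebraic-integer values
  — the `hdict` input of the BED assembly (`Summits/BirchSwinnertonDyer`, crux `ManinDatumSupercuspidalCMInert`, stub `S5`).

Nothing about BSD is proved here.

## References
* K. Ireland, M. Rosen, *A Classical Introduction to Modern Number Theory*, 2nd ed., GTM 84 (1990), Ch. 9 §3 Theorem 1 and §4
  (proof, case `π₁ = q ≡ 2 (3)`), Ch. 14 §2 (power residue symbol), Ch. 18 §7. [IrelandRosen1990] [IrelandRosen1982]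
* E. Hecke, *Eine neue Art von Zetafunktionen …* II, Math. Z. 6 (1920), §9. [Hecke1920]

## Mathlib / tree search
Tree: `SexticTwist.{weight_periodic, isIntegral_weight, sum_normEq_weight_eq, lSeries_coeff_parityLift, odd_absNorm_of_adm}` (prequel);
`EisensteinGrossen.{grossenNu_apply, psi_mul, psi_top, psi_asIdeal_eq, adm_mul_iff, Adm.coprime_three, primGen_mul, primGen_top,
span_primGen, primGen_sub_one_mem, primGen_span_singleton, primGen_eq_of, embC_tau, tau, tau_mkInt, coe_tau, hζ, three, mem_primesOver,
primeOf, absNorm_span_natCast, intCast_not_mem}`, `K3.{mkInt, mkInt_mul, mkInt_mul_conj, asIdeal_eq_of_mod_three_eq_two,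
prime_natCast_of_mod_three_eq_two, intCast_dvd_mkInt_iff, zetaInt}`; `cubicResidueSymbol_mul/_spec/_zero`,
`cubicResidueSymbol_natCast_eq_cubicResidueSymbol_cubicJacobiSum`, `cubicJacobiSum_eq_neg_of_span_eq`, `charP_quotient_of_natCast_mem`;
`sexticResidueSymbol_{spec, eq_of_pow_six_eq_one, zero, mul, sq}`, `mk_sexticResidueSymbol_pow_three`, `sexticResidueSymbol_pow_three_eq_one_or`,
`isPrimitiveRoot_neg_of_isPrimitiveRoot_three`.  Mathlib: `UniqueFactorizationMonoid.induction_on_prime`, `jacobiSym.mul_left/pow_left`,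
`jacobiSym.quadratic_reciprocity_one_mod_four`, `legendreSym.to_jacobiSym/eq_pow/eq_one_or_neg_one`, `ZMod.castHom`, `ZMod.pow_card`,
`add_pow_char`, `Ideal.quotientMap`, `UpperHalfPlane.ρ`.
-/

noncomputable section

open scoped Classical ComplexConjugate

open NumberField IsDedekindDomain Finset Complex
open Literature.NumberTheory.NumberFields Literature.NumberTheory.NumberFields.K3
open Literature.NumberTheory.GaloisRepresentations
open Literature.NumberTheory.LFunctions Literature.NumberTheory.LFunctions.NumberField
open Literature.NumberTheory.LFunctions.EisensteinGrossen Literature.NumberTheory.LFunctions.PlaneLattice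

namespace Literature.NumberTheory.EllipticCurves

namespace SexticTwist
/-! ### §3 The `5`-part of the weight -/

section Split

variable {v₅ : HeightOneSpectrum (𝓞 K3)} (hv : ((5 : ℤ) : 𝓞 K3) ∈ v₅.asIdeal)
include hv

/-- `v₅ = (5)`. [cite: IrelandRosen1990, Ch. 9 §1 Prop. 9.1.4] -/
theorem asIdeal_eq_span_five : v₅.asIdeal = Ideal.span {((5 : ℤ) : 𝓞 K3)} :=
  asIdeal_eq_of_mod_three_eq_two (by norm_num : Nat.Prime 5) (by norm_num) v₅ hv

/-- An element outside `(5)` generates an ideal prime to `(5^(e+1))` (and to `(3 · 5^(e+1))` if it is `≡ 1 (3)`-admissible).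
[cite: IrelandRosen1990, Ch. 9 §1 Prop. 9.1.4] -/
theorem isCoprime_span_five_pow {x : 𝓞 K3} (hx : x ∉ v₅.asIdeal) (e : ℕ) :
    IsCoprime (Ideal.span {x}) (Ideal.span {((5 : ℤ) : 𝓞 K3)} ^ e) := by
  refine IsCoprime.pow_right ?_
  rw [← asIdeal_eq_span_five hv, Ideal.isCoprime_iff_sup_eq]
  by_contra hne
  have hJ := v₅.isMaximal.eq_of_le hne le_sup_right
  have hxJ : x ∈ Ideal.span {x} ⊔ v₅.asIdeal := Ideal.mem_sup_left (Ideal.mem_span_singleton_self x)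
  rw [← hJ] at hxJ
  exact hx hxJ

/-- **The `5`-part of the weight**: for `k = 5^e k₁` (`e ≥ 1`) and every `x ∈ ℤ[ω]`,
`W_k(x) = \overline{e((x/5)₆)}^e · W_{k₁}(x)`, where `W_k(x) = 𝟙[x ≡ 1 (3)] c(N x) (k/N x) ν_{4k}((x))` is the theta weight of
`SexticTwistThetaDictionary` (`(k/N x) = (5/N x)^e (k₁/N x)` with `(5/N x) = e((x/5)₆)³`, `ν_{4k} = ν_5^e ν_{4k₁}` with
`ν_5((x)) = e((x/5)₃) = e((x/5)₆)²`, and `e((x/5)₆)⁵ = \overline{e((x/5)₆)}`).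
[cite: IrelandRosen1990, Ch. 18 §7 and Ch. 9 §3 Theorem 1] [cite: IrelandRosen1982, Ch. 14 §2, Prop. 14.2.2] -/
theorem weight_five_split {m : ℕ} (c : ZMod m → ℂ) {e : ℕ} (he : 1 ≤ e) {k₁ : ℤ} (x : 𝓞 K3) :
    (if x - 1 ∈ three then c ((Ideal.absNorm (Ideal.span {x}) : ℕ) : ZMod m) *
        (jacobiSym (5 ^ e * k₁) (Ideal.absNorm (Ideal.span {x})) : ℂ) * grossenNu ((4 * (5 ^ e * k₁) : ℤ) : 𝓞 K3) 1 0 (Ideal.span {x})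
      else 0) =
      conj (embC ((sexticResidueSymbol v₅ (Ideal.Quotient.mk v₅.asIdeal x) : 𝓞 K3) : K3)) ^ e *
        (if x - 1 ∈ three then c ((Ideal.absNorm (Ideal.span {x}) : ℕ) : ZMod m) *
          (jacobiSym k₁ (Ideal.absNorm (Ideal.span {x})) : ℂ) * grossenNu ((4 * k₁ : ℤ) : 𝓞 K3) 1 0 (Ideal.span {x}) else 0) := by
  letI := Ideal.Quotient.field v₅.asIdeal
  have hζ6 := isPrimitiveRoot_neg_of_isPrimitiveRoot_three EisensteinGrossen.hζ
  obtain ⟨h2₅, h3₅⟩ := two_three_not_mem_of_five_mem hv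
  obtain ⟨e, rfl⟩ : ∃ e', e = e' + 1 := ⟨e - 1, by omega⟩
  set D₅ : 𝓞 K3 := ((5 : ℤ) : 𝓞 K3) with hD₅
  set D₁ : 𝓞 K3 := ((4 * k₁ : ℤ) : 𝓞 K3) with hD₁
  have hD : ((4 * (5 ^ (e + 1) * k₁) : ℤ) : 𝓞 K3) = D₅ ^ (e + 1) * D₁ := by rw [hD₅, hD₁]; push_cast; ring
  by_cases h1 : x - 1 ∈ three
  swap
  · rw [if_neg h1, if_neg h1, mul_zero]
  rw [if_pos h1, if_pos h1]
  by_cases hx : x ∈ v₅.asIdeal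
  · -- `5 ∣ x`: both sides vanish
    have h0 : Ideal.Quotient.mk v₅.asIdeal x = 0 := Ideal.Quotient.eq_zero_iff_mem.mpr hx
    have hnadm : ¬ Adm ((4 * (5 ^ (e + 1) * k₁) : ℤ) : 𝓞 K3) (Ideal.span {x}) := by
      rintro ⟨-, hcop⟩
      rw [Ideal.isCoprime_iff_sup_eq] at hcop
      have hle : Ideal.span {x} ⊔ Ideal.span {3 * (((4 * (5 ^ (e + 1) * k₁) : ℤ) : 𝓞 K3))} ≤ v₅.asIdeal := by
        refine sup_le ((Ideal.span_singleton_le_iff_mem _).mpr hx) ((Ideal.span_singleton_le_iff_mem _).mpr ?_)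
        have : (3 : 𝓞 K3) * ((4 * (5 ^ (e + 1) * k₁) : ℤ) : 𝓞 K3) = ((12 * 5 ^ e * k₁ : ℤ) : 𝓞 K3) * ((5 : ℤ) : 𝓞 K3) := by
          push_cast; ring
        rw [this]
        exact v₅.asIdeal.mul_mem_left _ hv
      rw [hcop, top_le_iff] at hle
      exact v₅.isPrime.ne_top hle
    rw [grossenNu_apply, if_neg hnadm, h0, sexticResidueSymbol_zero hζ6 h2₅ h3₅, mul_zero]
    simp
  by_cases hadm : Adm D₁ (Ideal.span {x})
  swap
  · -- not admissible for `4k₁`: both sides vanish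
    have hnadm : ¬ Adm ((4 * (5 ^ (e + 1) * k₁) : ℤ) : 𝓞 K3) (Ideal.span {x}) := by
      rw [hD]; exact fun h ↦ hadm (adm_of_adm_mul_left h).2
    rw [grossenNu_apply, if_neg hnadm, grossenNu_apply, if_neg hadm, mul_zero, mul_zero, mul_zero]
  -- the admissible case
  have hx0 : x ≠ 0 := fun h ↦ hx (h ▸ v₅.asIdeal.zero_mem)
  have h3x : IsCoprime (Ideal.span {x}) three := hadm.coprime_three
  have hadm5 : Adm D₅ (Ideal.span {x}) := by
    refine ⟨by rwa [Ne, Ideal.span_singleton_eq_bot], ?_⟩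
    rw [show Ideal.span {3 * D₅} = three * Ideal.span {D₅} from (Ideal.span_singleton_mul_span_singleton _ _).symm]
    exact IsCoprime.mul_right h3x (by have h := isCoprime_span_five_pow hv hx 1; rwa [pow_one] at h)
  have hadmk : Adm (D₅ ^ (e + 1) * D₁) (Ideal.span {x}) := by
    refine ⟨hadm.1, ?_⟩
    rw [show Ideal.span {3 * (D₅ ^ (e + 1) * D₁)} = Ideal.span {3 * D₁} * Ideal.span {D₅} ^ (e + 1) by
      rw [Ideal.span_singleton_pow, Ideal.span_singleton_mul_span_singleton]; ring_nf]
    exact IsCoprime.mul_right hadm.2 (isCoprime_span_five_pow hv hx (e + 1))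
  -- `ν_{4k} = ν_5^(e+1) ν_{4k₁}` and `ν_5((x)) = e((x/5)₆)²`
  have hν : grossenNu ((4 * (5 ^ (e + 1) * k₁) : ℤ) : 𝓞 K3) 1 0 (Ideal.span {x}) =
      embC ((sexticResidueSymbol v₅ (Ideal.Quotient.mk v₅.asIdeal x) : 𝓞 K3) : K3) ^ (2 * (e + 1)) *
        grossenNu D₁ 1 0 (Ideal.span {x}) := by
    rw [hD, grossenNu_mul_left _ _ _ hadmk, grossenNu_pow_left _ _ hadm5, grossenNu_apply, if_pos hadm5, pow_one, sectorWeight,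
      pow_zero, mul_one, hD₅, psi_five_eq_cubicResidueSymbol_primGen hv _ hadm5, primGen_span_singleton h1,
      ← sexticResidueSymbol_sq hζ6 h2₅ h3₅, pow_mul]
    push_cast
    rw [map_pow]
  -- `(5^(e+1) k₁ / N x) = e((x/5)₆)^(3(e+1)) (k₁ / N x)`
  obtain ⟨a, b, hab⟩ := exists_eq_mkInt x
  have hodd : Odd (Ideal.absNorm (Ideal.span {x})) := by rw [hab] at hadm ⊢; exact odd_absNorm_of_adm k₁ hadm
  have hJ : (jacobiSym (5 ^ (e + 1) * k₁) (Ideal.absNorm (Ideal.span {x})) : ℂ) =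
      embC ((sexticResidueSymbol v₅ (Ideal.Quotient.mk v₅.asIdeal x) : 𝓞 K3) : K3) ^ (3 * (e + 1)) *
        (jacobiSym k₁ (Ideal.absNorm (Ideal.span {x})) : ℂ) := by
    rw [jacobiSym.mul_left, jacobiSym.pow_left, Int.cast_mul, Int.cast_pow, jacobiSym_five_absNorm_eq hv hx hodd, ← pow_mul]
  -- `e((x/5)₆)⁵ = conj e((x/5)₆)`
  set E : ℂ := embC ((sexticResidueSymbol v₅ (Ideal.Quotient.mk v₅.asIdeal x) : 𝓞 K3) : K3) with hE
  have hx0' : Ideal.Quotient.mk v₅.asIdeal x ≠ 0 := fun h ↦ hx (Ideal.Quotient.eq_zero_iff_mem.mp h)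
  have hE6 : E ^ 6 = 1 := by
    have h6 := (sexticResidueSymbol_spec hζ6 h2₅ h3₅ hx0').1
    have : ((sexticResidueSymbol v₅ (Ideal.Quotient.mk v₅.asIdeal x) ^ 6 : 𝓞 K3) : K3) = 1 := by rw [h6]; rfl
    rw [hE, ← map_pow]
    push_cast at this
    rw [this, map_one]
  have hE5 : E ^ 5 = conj E := by
    have hEne : E ≠ 0 := fun h ↦ by rw [h] at hE6; norm_num at hE6
    rw [conj_eq_inv_of_pow_eq_one (by norm_num) hE6]
    exact eq_inv_of_mul_eq_one_left (by rw [← pow_succ, hE6])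
  rw [hJ, hν, ← hE5]
  ring

/-- Classes modulo `(5)` of `a + bζ` only depend on `a, b` modulo `5`. [cite: IrelandRosen1990, Ch. 9 §1] -/
theorem mk_mkInt_eq_of_emod_eq {a b a' b' : ℤ} (ha : a % 5 = a' % 5) (hb : b % 5 = b' % 5) :
    Ideal.Quotient.mk v₅.asIdeal (mkInt a b) = Ideal.Quotient.mk v₅.asIdeal (mkInt a' b') := by
  rw [Ideal.Quotient.eq, asIdeal_eq_span_five hv, Ideal.mem_span_singleton]
  have e1 : mkInt a b - mkInt a' b' = mkInt (a - a') (b - b') := by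
    rw [sub_eq_iff_eq_add, mkInt_add]; congr 1 <;> ring
  rw [e1, intCast_dvd_mkInt_iff]
  constructor <;> omega

omit hv in
/-- The class of `a + bζ` for `a, b ∈ ℤ/5` read through representatives: `cast a + cast b · ζ` in `𝓞 K3 ⧸ (5)`.
[cite: IrelandRosen1990, Ch. 9 §1] -/
theorem mk_mkInt_val (a b : ZMod 5) :
    Ideal.Quotient.mk v₅.asIdeal (mkInt (a.val : ℤ) (b.val : ℤ)) =
      ((a.val : ℕ) : 𝓞 K3 ⧸ v₅.asIdeal) + ((b.val : ℕ) : 𝓞 K3 ⧸ v₅.asIdeal) * Ideal.Quotient.mk v₅.asIdeal zetaInt := by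
  rw [← intCast_add_mul_zetaInt, map_add, map_mul, map_intCast, map_intCast]
  push_cast
  ring

/-- **The sextic character on `(ℤ/5)²` in `ρ`-coordinates** `Φ₅(c₁, c₂) = e(((c₁ρ + c₂)/5)₆)^e` is multiplicative for the product
`(c₁ρ + c₂)(c′₁ρ + c′₂)`, vanishes at `0`, and takes the value `(−ρ²)^e` at `1 − ρ = (−1, 1)` (`(1 − ρ)⁴ = 9ρ² ≡ −ρ² (mod 5)`).
[cite: IrelandRosen1982, Ch. 14 §2, Prop. 14.2.2] -/
theorem sexticCharFive_props {e : ℕ} (he : 1 ≤ e) :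
    (fun c : ZMod 5 × ZMod 5 ↦ embC ((sexticResidueSymbol v₅ (Ideal.Quotient.mk v₅.asIdeal (mkInt (c.2.val : ℤ) (c.1.val : ℤ))) :
        𝓞 K3) : K3) ^ e) 0 = 0 ∧
    (∀ d d' : ZMod 5 × ZMod 5,
      (fun c : ZMod 5 × ZMod 5 ↦ embC ((sexticResidueSymbol v₅ (Ideal.Quotient.mk v₅.asIdeal (mkInt (c.2.val : ℤ) (c.1.val : ℤ))) :
          𝓞 K3) : K3) ^ e) (d.1 * d'.2 + d.2 * d'.1 - d.1 * d'.1, d.2 * d'.2 - d.1 * d'.1) =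
        (fun c : ZMod 5 × ZMod 5 ↦ embC ((sexticResidueSymbol v₅ (Ideal.Quotient.mk v₅.asIdeal (mkInt (c.2.val : ℤ) (c.1.val : ℤ))) :
            𝓞 K3) : K3) ^ e) d *
          (fun c : ZMod 5 × ZMod 5 ↦ embC ((sexticResidueSymbol v₅ (Ideal.Quotient.mk v₅.asIdeal (mkInt (c.2.val : ℤ) (c.1.val : ℤ))) :
            𝓞 K3) : K3) ^ e) d') ∧
    (fun c : ZMod 5 × ZMod 5 ↦ embC ((sexticResidueSymbol v₅ (Ideal.Quotient.mk v₅.asIdeal (mkInt (c.2.val : ℤ) (c.1.val : ℤ))) :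
        𝓞 K3) : K3) ^ e) (-1, 1) = (-(UpperHalfPlane.ρ : ℂ) ^ 2) ^ e ∧
    (∀ d : ZMod 5 × ZMod 5, IsIntegral ℤ ((fun c : ZMod 5 × ZMod 5 ↦ embC ((sexticResidueSymbol v₅ (Ideal.Quotient.mk v₅.asIdeal
        (mkInt (c.2.val : ℤ) (c.1.val : ℤ))) : 𝓞 K3) : K3) ^ e) d)) := by
  haveI := charP_five hv
  letI := Ideal.Quotient.field v₅.asIdeal
  have hζ6 := isPrimitiveRoot_neg_of_isPrimitiveRoot_three EisensteinGrossen.hζ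
  obtain ⟨h2₅, h3₅⟩ := two_three_not_mem_of_five_mem hv
  have he0 : e ≠ 0 := by omega
  set z := Ideal.Quotient.mk v₅.asIdeal zetaInt with hz
  have hz2 : z ^ 2 = -1 - z := by rw [hz, ← map_pow, zetaInt_sq, map_sub, map_neg, map_one]
  set ι := ZMod.castHom (dvd_refl 5) (𝓞 K3 ⧸ v₅.asIdeal) with hι
  have hval : ∀ x : ZMod 5, ((x.val : ℕ) : 𝓞 K3 ⧸ v₅.asIdeal) = ι x := fun x ↦ by
    rw [hι, ZMod.castHom_apply, ZMod.cast_eq_val]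
  have hcls : ∀ a b : ZMod 5, Ideal.Quotient.mk v₅.asIdeal (mkInt (a.val : ℤ) (b.val : ℤ)) = ι a + ι b * z := fun a b ↦ by
    rw [mk_mkInt_val, hval, hval]
  simp only
  refine ⟨?_, ?_, ?_, ?_⟩
  · rw [Prod.snd_zero, Prod.fst_zero, hcls, map_zero, zero_mul, add_zero, sexticResidueSymbol_zero hζ6 h2₅ h3₅]
    simp [he0]
  · intro d d'
    rw [hcls, hcls, hcls, ← mul_pow]
    congr 1
    have hprod : ι (d.2 * d'.2 - d.1 * d'.1) + ι (d.1 * d'.2 + d.2 * d'.1 - d.1 * d'.1) * z =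
        (ι d.2 + ι d.1 * z) * (ι d'.2 + ι d'.1 * z) := by
      simp only [map_add, map_sub, map_mul]
      linear_combination (-(ι d.1 * ι d'.1)) * hz2
    rw [hprod, sexticResidueSymbol_mul hζ6 h2₅ h3₅]
    push_cast
    rw [map_mul]
  · -- the class of `(-1, 1)` is `1 - ζ`, and `(1 - ζ)⁴ = -ζ²`
    rw [hcls]
    have hcl : ι (1 : ZMod 5) + ι (-1 : ZMod 5) * z = 1 - z := by
      simp only [map_one, map_neg]; ring
    rw [hcl]
    have h10 : (10 : 𝓞 K3 ⧸ v₅.asIdeal) = 0 := by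
      have := CharP.cast_eq_zero (𝓞 K3 ⧸ v₅.asIdeal) 5
      linear_combination (2 : 𝓞 K3 ⧸ v₅.asIdeal) * this
    have hsym : sexticResidueSymbol v₅ (1 - z) = -zetaInt ^ 2 := by
      refine sexticResidueSymbol_eq_of_pow_six_eq_one hζ6 h2₅ h3₅ ?_ ?_
      · rw [neg_pow, ← pow_mul, show 2 * 6 = 3 * 4 by norm_num, pow_mul, EisensteinGrossen.hζ.pow_eq_one]; norm_num
      · rw [residueCard_eq_of_five_mem hv, show ((5 ^ 2 - 1) / 6 : ℕ) = 4 by norm_num, map_neg, map_pow, ← hz]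
        linear_combination (-z ^ 2 + 5 * z - 11) * hz2 + (z + 1) * h10
    rw [hsym]
    push_cast
    rw [map_neg, map_pow]
    simp only [coe_zetaInt, embC_zeta]
    rfl
  · intro d
    refine IsIntegral.pow ?_ e
    rcases sexticResidueSymbol_eq_zero_or_pow_six hζ6 h2₅ h3₅ (Ideal.Quotient.mk v₅.asIdeal (mkInt (d.2.val : ℤ) (d.1.val : ℤ)))
      with h0 | h6
    · rw [h0]; simp [isIntegral_zero]
    · refine IsIntegral.of_pow (by norm_num : 0 < 6) ?_
      have hc := congrArg (fun t : 𝓞 K3 ↦ (t : K3)) h6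
      push_cast at hc
      rw [← map_pow, hc, map_one]
      exact isIntegral_one

/-- **The `5`-part in QuadOrder's `ℤ²`-coordinates**: with `Φ_k(y) = W_k(y₁ − y₂ζ)` (the `Φ` of `lSeries_twist_eq_thetaLFunction`, `γ_y = y₁ + y₂ω₃ =
\overline{e(y₁ − y₂ζ)} = e(y₂ζ + (y₁ + y₂))`): `Φ_k(y) = Φ₅(y₂, y₁ + y₂) · Φ_{k₁}(y)` for `k = 5^e k₁`, where `Φ₅(c₁, c₂) = e(((c₁ζ + c₂)/5)₆)^e`
(`\overline{e((τγ/5)₆)} = e((γ/5)₆)`). [cite: IrelandRosen1990, Ch. 18 §7] [cite: IrelandRosen1982, Ch. 14 §2, Prop. 14.2.2] -/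
theorem thetaWeight_five_split {m : ℕ} (c : ZMod m → ℂ) {e : ℕ} (he : 1 ≤ e) {k₁ : ℤ} (y : ℤ × ℤ) :
    (fun x : 𝓞 K3 ↦ if x - 1 ∈ three then c ((Ideal.absNorm (Ideal.span {x}) : ℕ) : ZMod m) *
        (jacobiSym (5 ^ e * k₁) (Ideal.absNorm (Ideal.span {x})) : ℂ) * grossenNu ((4 * (5 ^ e * k₁) : ℤ) : 𝓞 K3) 1 0 (Ideal.span {x})
        else 0) (mkInt y.1 (-y.2)) =
      (fun c : ZMod 5 × ZMod 5 ↦ embC ((sexticResidueSymbol v₅ (Ideal.Quotient.mk v₅.asIdeal (mkInt (c.2.val : ℤ) (c.1.val : ℤ))) :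
          𝓞 K3) : K3) ^ e) ((y.2 : ZMod 5), ((y.1 + y.2 : ℤ) : ZMod 5)) *
        (fun x : 𝓞 K3 ↦ if x - 1 ∈ three then c ((Ideal.absNorm (Ideal.span {x}) : ℕ) : ZMod m) *
          (jacobiSym k₁ (Ideal.absNorm (Ideal.span {x})) : ℂ) * grossenNu ((4 * k₁ : ℤ) : 𝓞 K3) 1 0 (Ideal.span {x}) else 0)
          (mkInt y.1 (-y.2)) := by
  simp only
  rw [weight_five_split hv c he (mkInt y.1 (-y.2)), ← embC_sexticResidueSymbol_tau hv, tau_mkInt]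
  have hcl : Ideal.Quotient.mk v₅.asIdeal (mkInt (y.1 - -y.2) (-(-y.2))) =
      Ideal.Quotient.mk v₅.asIdeal (mkInt ((((y.1 + y.2 : ℤ) : ZMod 5)).val : ℤ) (((y.2 : ZMod 5)).val : ℤ)) := by
    rw [show y.1 - -y.2 = y.1 + y.2 by ring, neg_neg]
    exact mk_mkInt_eq_of_emod_eq hv (by rw [ZMod.val_intCast]; omega) (by rw [ZMod.val_intCast]; omega)
  rw [hcl]

end Split

/-! ### §4 The dictionary at level `5·M′` with the `5`-character split off -/

section Main

variable {k : ℤ} {m : ℕ}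

/-- `k = 5^e · k₁` with `5 ∤ k₁`, for `k ≠ 0`. [cite: IrelandRosen1990, Ch. 18 §7] -/
private theorem exists_eq_five_pow_mul (hk : k ≠ 0) : ∃ (e : ℕ) (k₁ : ℤ), k = 5 ^ e * k₁ ∧ ¬ (5 : ℤ) ∣ k₁ := by
  obtain ⟨e, n', hn', hkn⟩ := Nat.exists_eq_pow_mul_and_not_dvd (Int.natAbs_ne_zero.mpr hk) 5 (by norm_num)
  have hn'' : ¬ (5 : ℤ) ∣ (n' : ℤ) := by exact_mod_cast hn'
  rcases Int.natAbs_eq k with h | h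
  · refine ⟨e, n', ?_, hn''⟩
    conv_lhs => rw [h, hkn]
    push_cast; ring
  · refine ⟨e, -n', ?_, by rwa [dvd_neg]⟩
    conv_lhs => rw [h, hkn]
    push_cast
    ring

/-- ★ **The `hdict` input of the `j = 0` supercuspidal cell: Theorem 18.7 for `y² = x³ + k`, `5 ∣ k`, at level `5 · M′` with the sextic character
at `5` split off.**  For `k ≠ 0` sixth-power-free, not `16u` with `u ≡ 1 (4)`, `5 ∣ k`, `m ≥ 1` prime to `5` and `c : ℤ/m → ℂ`: there are
`e = v₅(k) ∈ [1, 5]`, `k₁ = k/5^e`, `M′ = 36|k₁|m` (prime to `5`), the character `Φ₅(c₁, c₂) = e(((c₁ρ + c₂)/5)₆)^e` of `(ℤ/5)²` (multiplicative,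
`Φ₅(0) = 0`, `Φ₅(1 − ρ) = (−ρ²)^e`, algebraic-integer values) and the weight `Ψ = Φ_{k₁}` (periodic modulo `M′`, algebraic-integer values when `c`
has them, given by the explicit formula of `SexticTwistThetaDictionary`) with, for `re s > 3/2`,
`Σ_n c(n) a_n(E^k) n⁻ˢ = (4^s/2) · BinaryTheta.thetaLFunction 3 (2·(5M′)) 1 (−√3 i) (parityLift (y ↦ Φ₅(y₂, y₁ + y₂) Ψ(y))) s`
(QuadOrder coordinates `γ_y = y₁ + y₂ω₃ = y₂ρ + (y₁ + y₂)`). [cite: IrelandRosen1990, Ch. 18 §7 and §5 Theorem 6] [cite: Hecke1920, §9] -/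
theorem lSeries_twist_eq_thetaLFunction_five (hk : k ≠ 0) (h6 : ∀ q : ℕ, q.Prime → ¬ (q : ℤ) ^ 6 ∣ k)
    (h2 : ¬ ∃ u : ℤ, u % 4 = 1 ∧ k = 16 * u) (h5 : (5 : ℤ) ∣ k) [NeZero m] (h5m : ¬ 5 ∣ m) (c : ZMod m → ℂ) :
    ∃ (e : ℕ) (k₁ : ℤ) (M' : ℕ) (_ : NeZero M') (_ : NeZero (2 * (5 * M'))) (Φ₅ : ZMod 5 × ZMod 5 → ℂ) (Ψ : ℤ × ℤ → ℂ),
      1 ≤ e ∧ e ≤ 5 ∧ k = 5 ^ e * k₁ ∧ ¬ (5 : ℤ) ∣ k₁ ∧ M' = 36 * k₁.natAbs * m ∧ Nat.Coprime 5 M' ∧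
      Φ₅ 0 = 0 ∧
      (∀ d d' : ZMod 5 × ZMod 5, Φ₅ (d.1 * d'.2 + d.2 * d'.1 - d.1 * d'.1, d.2 * d'.2 - d.1 * d'.1) = Φ₅ d * Φ₅ d') ∧
      Φ₅ (-1, 1) = (-(UpperHalfPlane.ρ : ℂ) ^ 2) ^ e ∧
      (∀ d : ZMod 5 × ZMod 5, IsIntegral ℤ (Φ₅ d)) ∧
      (∀ y z : ℤ × ℤ, Ψ (y.1 + M' * z.1, y.2 + M' * z.2) = Ψ y) ∧
      ((∀ a, IsIntegral ℤ (c a)) → ∀ y : ℤ × ℤ, IsIntegral ℤ (Ψ y)) ∧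
      (∀ y : ℤ × ℤ, Ψ y = (fun x : 𝓞 K3 ↦ if x - 1 ∈ three then c ((Ideal.absNorm (Ideal.span {x}) : ℕ) : ZMod m) *
          (jacobiSym k₁ (Ideal.absNorm (Ideal.span {x})) : ℂ) * grossenNu ((4 * k₁ : ℤ) : 𝓞 K3) 1 0 (Ideal.span {x}) else 0)
          (mkInt y.1 (-y.2))) ∧
      ∀ s : ℂ, 3 / 2 < s.re →
        LSeries (fun n : ℕ ↦ c (n : ZMod m) * ((mordellCurve (k : ℚ)).LFunction n : ℂ)) s =
          (4 : ℂ) ^ s / 2 * BinaryTheta.thetaLFunction 3 (2 * (5 * M')) 1 (-((Real.sqrt 3 : ℂ) * I))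
            (QuadOrder.parityLift fun y : ℤ × ℤ ↦ Φ₅ ((y.2 : ZMod 5), ((y.1 + y.2 : ℤ) : ZMod 5)) * Ψ y) s := by
  obtain ⟨e, k₁, hke, hk₁⟩ := exists_eq_five_pow_mul hk
  have he1 : 1 ≤ e := by
    by_contra h0
    have : e = 0 := by omega
    subst this
    rw [pow_zero, one_mul] at hke
    exact hk₁ (hke ▸ h5)
  have he5 : e ≤ 5 := by
    by_contra h
    exact h6 5 (by norm_num) (hke ▸ (pow_dvd_pow (5 : ℤ) (by omega)).mul_right k₁)
  have hk₁0 : k₁ ≠ 0 := by rintro rfl; exact hk (by rw [hke, mul_zero])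
  subst hke
  -- the prime `(5)`
  set v₅ : HeightOneSpectrum (𝓞 K3) := primeOf (prime_natCast_of_mod_three_eq_two (by norm_num : Nat.Prime 5) (by norm_num))
    with hv₅
  have hv : ((5 : ℤ) : 𝓞 K3) ∈ v₅.asIdeal := Ideal.mem_span_singleton_self _
  -- the level `M' = 36 |k₁| m`
  set M' : ℕ := 36 * k₁.natAbs * m with hM'
  haveI hM'0 : NeZero M' :=
    ⟨by rw [hM']; exact Nat.mul_ne_zero (Nat.mul_ne_zero (by norm_num) (Int.natAbs_ne_zero.mpr hk₁0)) (NeZero.ne m)⟩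
  haveI h10M : NeZero (2 * (5 * M')) := ⟨Nat.mul_ne_zero two_ne_zero (Nat.mul_ne_zero (by norm_num) (NeZero.ne M'))⟩
  have hcop : Nat.Coprime 5 M' := by
    rw [hM', Nat.Prime.coprime_iff_not_dvd (by norm_num : Nat.Prime 5)]
    intro h
    rcases (Nat.Prime.dvd_mul (by norm_num : Nat.Prime 5)).mp h with h36 | hm
    · rcases (Nat.Prime.dvd_mul (by norm_num : Nat.Prime 5)).mp h36 with h36' | hk'
      · norm_num at h36'
      · exact hk₁ (Int.ofNat_dvd_left.mpr hk')
    · exact h5m hm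
  -- the two factors
  set Φ₅ : ZMod 5 × ZMod 5 → ℂ := fun c : ZMod 5 × ZMod 5 ↦
    embC ((sexticResidueSymbol v₅ (Ideal.Quotient.mk v₅.asIdeal (mkInt (c.2.val : ℤ) (c.1.val : ℤ))) : 𝓞 K3) : K3) ^ e with hΦ₅
  set W₁ : 𝓞 K3 → ℂ := fun x : 𝓞 K3 ↦ if x - 1 ∈ three then c ((Ideal.absNorm (Ideal.span {x}) : ℕ) : ZMod m) *
      (jacobiSym k₁ (Ideal.absNorm (Ideal.span {x})) : ℂ) * grossenNu ((4 * k₁ : ℤ) : 𝓞 K3) 1 0 (Ideal.span {x}) else 0 with hW₁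
  set W : 𝓞 K3 → ℂ := fun x : 𝓞 K3 ↦ if x - 1 ∈ three then c ((Ideal.absNorm (Ideal.span {x}) : ℕ) : ZMod m) *
      (jacobiSym (5 ^ e * k₁) (Ideal.absNorm (Ideal.span {x})) : ℂ) * grossenNu ((4 * (5 ^ e * k₁) : ℤ) : 𝓞 K3) 1 0 (Ideal.span {x})
      else 0 with hW
  set Ψ : ℤ × ℤ → ℂ := fun y : ℤ × ℤ ↦ W₁ (mkInt y.1 (-y.2)) with hΨdef
  obtain ⟨hΦ0, hΦmul, hΦgen, hΦint⟩ := sexticCharFive_props hv he1 (e := e)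
  -- periodicity of `Ψ` modulo `M'`
  have hΨ : ∀ y z : ℤ × ℤ, Ψ (y.1 + M' * z.1, y.2 + M' * z.2) = Ψ y := by
    intro y z
    have h := weight_periodic k₁ m c (mkInt y.1 (-y.2)) (mkInt z.1 (-z.2))
    change W₁ (mkInt y.1 (-y.2) + ((36 * k₁.natAbs * m : ℕ) : 𝓞 K3) * mkInt z.1 (-z.2)) = W₁ (mkInt y.1 (-y.2)) at h
    have eq : mkInt y.1 (-y.2) + ((36 * k₁.natAbs * m : ℕ) : 𝓞 K3) * mkInt z.1 (-z.2) = mkInt (y.1 + M' * z.1) (-(y.2 + M' * z.2)) := by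
      rw [← hM', show ((M' : ℕ) : 𝓞 K3) = mkInt M' 0 by rw [mkInt_intCast]; push_cast; rfl, mkInt_mul, mkInt_add]
      congr 1 <;> ring
    rw [eq] at h
    exact h
  -- the factorisation and the `5M'`-periodicity of the full weight
  have hfac : (fun y : ℤ × ℤ ↦ Φ₅ ((y.2 : ZMod 5), ((y.1 + y.2 : ℤ) : ZMod 5)) * Ψ y) = fun y : ℤ × ℤ ↦ W (mkInt y.1 (-y.2)) :=
    funext fun y ↦ (thetaWeight_five_split hv c he1 (k₁ := k₁) y).symm
  have hΘ : ∀ y z : ℤ × ℤ, (fun y : ℤ × ℤ ↦ Φ₅ ((y.2 : ZMod 5), ((y.1 + y.2 : ℤ) : ZMod 5)) * Ψ y) (y.1 + (5 * M' : ℕ) * z.1,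
      y.2 + (5 * M' : ℕ) * z.2) = (fun y : ℤ × ℤ ↦ Φ₅ ((y.2 : ZMod 5), ((y.1 + y.2 : ℤ) : ZMod 5)) * Ψ y) y := by
    intro y z
    simp only
    have h50 : (5 : ZMod 5) = 0 := by decide
    have h1 : ((y.2 + (5 * M' : ℕ) * z.2 : ℤ) : ZMod 5) = (y.2 : ZMod 5) := by
      push_cast; rw [h50]; ring
    have h2 : ((y.1 + (5 * M' : ℕ) * z.1 + (y.2 + (5 * M' : ℕ) * z.2) : ℤ) : ZMod 5) = ((y.1 + y.2 : ℤ) : ZMod 5) := by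
      push_cast; rw [h50]; ring
    have h3 : Ψ (y.1 + (5 * M' : ℕ) * z.1, y.2 + (5 * M' : ℕ) * z.2) = Ψ y := by
      have := hΨ y (5 * z.1, 5 * z.2)
      simp only at this
      rw [← this]
      congr 1
      · push_cast; ring
    rw [h1, h2, h3]
  refine ⟨e, k₁, M', hM'0, h10M, Φ₅, Ψ, he1, he5, rfl, hk₁, rfl, hcop, hΦ0, hΦmul, hΦgen, hΦint, hΨ,
    fun hc y ↦ isIntegral_weight k₁ m c hc _, fun y ↦ rfl, fun s hs ↦ ?_⟩
  rw [BinaryTheta.thetaLFunction_eq_LSeries 3 (2 * (5 * M')) 1 _ _ (QuadOrder.parityLift_periodic (5 * M') _ hΘ) hs, hfac,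
    lSeries_coeff_parityLift W s, LSeries_congr (fun {n} _ ↦ sum_normEq_weight_eq hk h6 h2 c n) s]
  have h4 : (4 : ℂ) ^ s ≠ 0 := by
    rw [Ne, cpow_eq_zero_iff, not_and_or]; exact Or.inl (by norm_num)
  rw [cpow_neg]
  field_simp

end Main

end SexticTwist

end Literature.NumberTheory.EllipticCurves

end
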